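import Mathlib
import Summits.Ventures.PercRepro2.Defs
import Summits.Ventures.PercRepro2.Independence
import Summits.Ventures.PercRepro2.Harris
import Summits.Ventures.PercRepro2.Graph
import Summits.Ventures.PercRepro2.Events
import Summits.Ventures.PercRepro2.ZCClusterBlind

/-!
# The root cluster is the root plus the `G − a₁`-clusters of its open neighbours (blind cell PercRepro2, mine-a g28)

`C(a₁) = {a₁} ∪ ⋃ {C'(v) : the edge a₁–v is open}`, where `C'(v)` is the cluster of `v` in `G − a₁`
(`deleteVertex`: every edge at `a₁` closed).  This is the «a₁-deleted revealment» of MINE-A.md §77.0: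
reveal `G − a₁` first, then the edges at `a₁`; the root cluster is the union of the blocks that the
open edges of `a₁` attach.  Proof: the right-hand side contains `a₁` and is closed under open adjacency
(an open edge from a vertex of `C'(v)` leads either back to `a₁` or, avoiding `a₁`, stays in `C'(v)`), so
it contains `C(a₁)` by the closure lemma; the converse inclusion is monotonicity and transitivity.
-/

namespace Summit.Ventures.PercRepro2

variable {V : Type*} {E : Type*} [Fintype V] [DecidableEq V]

/-- The open neighbours of `a₁`: `{v | some open edge has endpoints {a₁, v}}`. -/
def openNbr (ends : E → Sym2 V) (ω : Config E) (a₁ : V) : Set V := {v | OpenAdj ends ω a₁ v}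

/-- An edge not touching `a₁` keeps its state in `G − a₁`. -/
lemma deleteVertex_apply_of_not_touch {ends : E → Sym2 V} {a₁ : V} (ω : Config E) {e : E}
    {x y : V} (hxy : ends e = s(x, y)) (hx : x ≠ a₁) (hy : y ≠ a₁) :
    deleteVertex ends a₁ ω e = ω e := by
  unfold deleteVertex
  apply restrict_apply_of_mem
  intro he
  rcases mem_touches.1 he with ⟨z, hz, w, hzw⟩
  simp only [Finset.coe_singleton, Set.mem_singleton_iff] at hz
  subst hz
  rw [hxy] at hzw
  rcases Sym2.eq_iff.1 hzw with ⟨h1, _⟩ | ⟨_, h2⟩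
  · exact hx h1
  · exact hy h2

/-- Open adjacency avoiding `a₁` survives in `G − a₁`. -/
lemma openAdj_deleteVertex_of_ne {ends : E → Sym2 V} {a₁ : V} {ω : Config E} {x y : V}
    (h : OpenAdj ends ω x y) (hx : x ≠ a₁) (hy : y ≠ a₁) :
    OpenAdj ends (deleteVertex ends a₁ ω) x y := by
  obtain ⟨e, he, hends⟩ := h
  exact ⟨e, by rw [deleteVertex_apply_of_not_touch ω hends hx hy]; exact he, hends⟩

/-- No vertex other than `a₁` is connected to `a₁` in `G − a₁`. -/
lemma not_conn_deleteVertex {ends : E → Sym2 V} {a₁ : V} {ω : Config E} {u : V} (hu : u ≠ a₁) :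
    ¬ Conn ends (deleteVertex ends a₁ ω) u a₁ := by
  intro h
  have key : a₁ ∈ {x | x ≠ a₁} := by
    refine mem_of_conn_of_closed (ends := ends) (ω := deleteVertex ends a₁ ω) ?_ hu h
    intro x hx y hxy
    obtain ⟨_, e, he, hends⟩ := openGraph_adj.1 hxy
    have he' : e ∉ touches ends (↑({a₁} : Finset V) : Set V) := by
      unfold deleteVertex at he
      exact (restrict_eq_true_iff.1 he).2
    have := (not_mem_of_not_mem_touches hends he').2
    simpa using this
  exact key rfl

/-- **The root decomposition**: `C(a₁) = {a₁} ∪ ⋃_{v open neighbour of a₁} C'(v)`. -/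
theorem cluster_root_decomp (ends : E → Sym2 V) (ω : Config E) (a₁ : V) :
    cluster ends ω a₁ =
      insert a₁ (⋃ v ∈ openNbr ends ω a₁, cluster ends (deleteVertex ends a₁ ω) v) := by
  apply Set.Subset.antisymm
  · -- closure argument
    intro u hu
    refine mem_of_conn_of_closed (ends := ends) (ω := ω) ?_ (Set.mem_insert a₁ _) hu
    intro x hx y hxy
    obtain ⟨hne, hadj⟩ := openGraph_adj.1 hxy
    by_cases hy : y = a₁
    · subst hy
      exact Set.mem_insert _ _
    by_cases hx1 : x = a₁
    · -- `x = a₁`: `y` is an open neighbour, and `y ∈ C'(y)`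
      subst hx1
      exact Set.mem_insert_of_mem _ (Set.mem_iUnion₂.2 ⟨y, hadj, mem_cluster_self _ _ _⟩)
    · rcases Set.mem_insert_iff.1 hx with rfl | hx'
      · exact absurd rfl hx1
      · obtain ⟨v, hv, hxv⟩ := Set.mem_iUnion₂.1 hx'
        -- the edge `x–y` avoids `a₁`, so it is open in `G − a₁` and `y` stays in `C'(v)`
        refine Set.mem_insert_of_mem _ (Set.mem_iUnion₂.2 ⟨v, hv, ?_⟩)
        exact mem_cluster_of_adj hxv (openGraph_adj.2 ⟨hne, openAdj_deleteVertex_of_ne hadj hx1 hy⟩)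
  · -- converse: monotonicity and transitivity
    intro u hu
    rcases Set.mem_insert_iff.1 hu with rfl | hu'
    · exact mem_cluster_self _ _ _
    · obtain ⟨v, hv, huv⟩ := Set.mem_iUnion₂.1 hu'
      have h1 : Conn ends ω a₁ v := conn_of_openAdj hv
      have h2 : Conn ends ω v u := conn_mono (deleteVertex_le ends a₁ ω) huv
      exact conn_trans h1 h2

end Summit.Ventures.PercRepro2
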